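/-
Copyright (c) 2026. Released under the Apache 2.0 license.
-/
import Literature.NumberTheory.EllipticCurves.ModularJacobianNeronDifferentialsTame
import Literature.NumberTheory.EllipticCurves.ModularCurveManinConstantProofs
import Literature.NumberTheory.EllipticCurves.Gamma1NewformLSeriesProofs
import Literature.NumberTheory.EllipticCurves.ModularSymbolsLattice
import Literature.NumberTheory.EllipticCurves.CuspFormsGamma0IntegralBasisProofs
import Mathlib.RingTheory.Polynomial.Eisenstein.Basic
import Mathlib.RingTheory.Polynomial.GaussLemma
import Mathlib.RingTheory.PowerBasis
import HarnessLib

/-!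
# Tame Néron lattices of `J₀(N)`: the algebra of `ϖ = e^{πi/e}p^{1/e}`, primitivity of newforms, and
# the «jump formula» `col_K + jdeg = a + e·v_p(c)` with its corollaries (THEOREMS over
# `TameNeronFormsAt`; no named fact)

Topic `NumberTheory/EllipticCurves`; namespace `Literature.NumberTheory.EllipticCurves.ModularForms`.
Companion of `ModularJacobianNeronDifferentialsTame.lean` (hypothesis structure `TameNeronFormsAt N p e`,
definition request `defn-NeronCotangentJumpFiltration` of the BSD ideation cell `bsd-idea-3`, LINE 38
of route `TameQuarticManinParity`). Everything here is PROVED from the structure fields, from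
Mathlib, and from landed tree theorems; nothing is posited. What the theorems mean for the actual
Néron models is governed by the HONESTY audit of the companion file (the fields are printed
statements about the true lattices; `jdeg`/`tameColength` are dictionary quantities).

## Contents

§1 The scalar `ϖ` (`tameUnif p e`, `ϖ^e = −p`): `X^e + p` is irreducible over `ℤ` (Eisenstein,
  Mathlib `Polynomial.IsEisensteinAt.irreducible`) and over `ℚ` (Gauss), so it is the minimal
  polynomial of `ϖ` and `1, ϖ, …, ϖ^{e−1}` are `ℚ`-linearly independent
  (`linearIndependent_tameUnif_pow`); consequently the normal form `∑_{i<e} t_i ϖ^i` of an element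
  of `O_K = ℤ_(p)[ϖ]` is unique, a rational number of the form `ϖ·x`, `x ∈ O_K`, is `−p·t` with
  `t ∈ ℤ_(p)` (`exists_eq_neg_mul_of_ratCast_eq_tameUnif_mul`), `ϖ` is not a unit of `O_K`
  (`one_ne_tameUnif_mul`) and an integer in `ϖ O_K` is divisible by `p`
  (`dvd_of_natCast_eq_tameUnif_mul`) — Serre, *Local Fields* I §6 (Eisenstein equations).
§2 For `Λ : TameNeronFormsAt N p e`: the `q`-expansion coefficients of `O_K·L` lie in `O_K`
  (`isTameIntegral_cuspCoeff_of_mem_spanK`, from `coeff_integral`), hence a NORMALISED form `f ∈ L`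
  is primitive: `f ∉ ϖ·(O_K L) ⊇ ϖ L_K` (`ne_tameUnif_smul_of_mem_spanK`; ČNS Rem. 5.16 "`ω_f` is a
  primitive element of this lattice", here over `O_K`).
§3 The certified lattice kernel of LINE 38 (the cell's `Sketch38.lean`, re-proved over the carrier):
  for primitive `f ∈ L` with `ϖ^n f ∈ L_K`, `ϖ^n f ∈ ϖ^m L_K ⟺ m + jdeg f ≤ n` (`inPowK_pow_smul_iff`);
  hence **formula (B)** `tameColength D a + jdeg f = a + e·v_p(c)` as soon as `ϖ^a c f ∈ L_K`
  (`tameColength_add_jdeg_eq`; under `HasTameGoodModel` via the field `tame_smul_memK`: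
  `tameColength_add_jdeg_eq_of_hasTameGoodModel`) — at the true lattices this is Edixhoven's
  `v_p(c) = (v_C(φ^*ω_U) − a)/n` read model-free, with `col_K = length_{O_K} coker(Lie 𝒥_K → Lie ℰ_K)`;
  **(C1)** `p ∤ c ⟺ tameColength ≤ a` (`not_dvd_maninConstant_iff_tameColength_le`);
  **(C2)** `tameColength = 0 ⇒ p ∤ c ∧ jdeg f = a`; **(C3)** `p ∤ deg φ ⇒ tameColength = 0`
  (`tameColength_eq_zero_of_not_dvd_modularDegree`, from `tame_pullback_integralK` at `g = ϖ^{a−1}c f`);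
  and the `R`-level consequence `v_p(c) ≤ v_p(deg φ)` of `pullback_integral` (ČNS Thm. 1.2 / 7.2 at
  `p`, `padicValInt_maninConstant_le_padicValNat_modularDegree`) — the non-vacuity witness of the
  HONESTY audit.
§4 A worked instance of the `K`-side hypothesis: `hasTameGoodModel_three_eight_two_of_short` — for
  `y² = x³ + Ax + B`, `v₃(A) = 1`, `9 ∣ B` (Kodaira III at `3`), `HasTameGoodModel 3 8 W 2` holds with
  `(u, r, s, t) = (ϖ², 0, 0, 0)` (so the `O_K`-fields of `TameNeronFormsAt N 3 8` are not vacuous on III rows).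
§5 The general III row at `3` (towards the route's support item S41 `TprimeIIIHasTameGoodModel`, which stays
  the prover's): `hasTameGoodModel_three_eight_two_of_tateNormalForm` — any `W/ℚ` in type-III Tate normal
  form at `3` (`v₃(aᵢ/3) ≥ 0` for `i ≤ 4`, `v₃(a₆/9) ≥ 0`, `v₃(Δ) = 3`; Silverman *ATAEC* IV.9.4 Step 4,
  the shape delivered by the tree's `exists_variableChange_tateNormalForm_III`) has
  `HasTameGoodModel 3 8 W 2` via `(ϖ², 0, 0, 0)`; and `HasTameGoodModel.of_variableChange` — invariance of
  `HasTameGoodModel p e · a` under `p`-integral changes of variables with `v_p(u) = 0` (Silverman *AEC*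
  VII.1.3 (d)), so a globally minimal `W` inherits it from its Tate normal form `C • W`.
No summit statement is touched; BSD is not advanced by this file.

## References

* [SerreLocalFields1979] J.-P. Serre, *Local Fields*, Ch. I §6, Prop. 17–18 (Eisenstein polynomials:
  total ramification, `A_L = A_K[π]`).
* [CesnaviciusNeururerSaha2023] K. Česnavičius, M. Neururer, A. Saha, JEMS 26 (2024) = arXiv:1911.09446v3:
  Rem. 5.16 (p. 40), Lemma 7.1, Thm. 7.2 and proof (pp. 46–47).
* [HalleNicaise2016] L. H. Halle, J. Nicaise, LNM 2156, Part II §1.1–§1.3 (elementary divisors,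
  `Lie(h)`, jumps).
* [EdixhovenManin1991] B. Edixhoven, *On the Manin constants of modular elliptic curves* (1991), §4
  (`v_p(c) = (v_C(φ^*ω_U) − a)/n`; Prop. 8).
-/

noncomputable section

open scoped MatrixGroups ModularForm

open CongruenceSubgroup UpperHalfPlane Polynomial

namespace Literature.NumberTheory.EllipticCurves.ModularForms

/-! ### §1 The algebra of `ϖ`: `X^e + p` is the minimal polynomial -/

section Scalars

/-- `X^e + p ∈ ℤ[X]` (`p` prime, `e ≥ 1`) is irreducible: it is Eisenstein at `(p)`.
[cite: SerreLocalFields1979, Ch. I §6, Prop. 17] -/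
theorem irreducible_X_pow_add_C_int {p : ℕ} (hp : p.Prime) {e : ℕ} (he : 0 < e) :
    Irreducible (X ^ e + C (p : ℤ) : ℤ[X]) := by
  set f : ℤ[X] := X ^ e + C (p : ℤ) with hf
  have hdeg : f.natDegree = e := natDegree_X_pow_add_C
  have hmonic : f.Monic := monic_X_pow_add_C _ he.ne'
  have hP : (Ideal.span {(p : ℤ)}).IsPrime := by
    rw [Ideal.span_singleton_prime (by exact_mod_cast hp.ne_zero)]
    exact Nat.prime_iff_prime_int.mp hp
  have hEis : f.IsEisensteinAt (Ideal.span {(p : ℤ)}) := by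
    refine ⟨?_, ?_, ?_⟩
    · rw [hmonic.leadingCoeff]
      exact (Ideal.ne_top_iff_one _).mp hP.ne_top
    · intro n hn
      rw [hdeg] at hn
      rw [hf, coeff_add, coeff_X_pow, if_neg hn.ne, zero_add, coeff_C]
      split_ifs with h0
      · exact Ideal.mem_span_singleton_self _
      · exact Ideal.zero_mem _
    · rw [hf, coeff_add, coeff_X_pow, if_neg he.ne, zero_add, coeff_C_zero, Ideal.span_singleton_pow,
        Ideal.mem_span_singleton]
      intro h
      have : (p : ℤ) ∣ 1 := by
        have h2 : (p : ℤ) * p ∣ (p : ℤ) * 1 := by simpa [sq] using h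
        exact (mul_dvd_mul_iff_left (by exact_mod_cast hp.ne_zero)).mp h2
      exact hp.ne_one (by exact_mod_cast Int.eq_one_of_dvd_one (by positivity) this)
  exact hEis.irreducible hP hmonic.isPrimitive (by rw [hdeg]; exact he)

/-- `X^e + p ∈ ℚ[X]` is irreducible (Gauss's lemma from the integral statement).
[cite: SerreLocalFields1979, Ch. I §6, Prop. 17] -/
theorem irreducible_X_pow_add_C_rat {p : ℕ} (hp : p.Prime) {e : ℕ} (he : 0 < e) :
    Irreducible (X ^ e + C (p : ℚ) : ℚ[X]) := by
  have h := irreducible_X_pow_add_C_int hp he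
  have hprim : (X ^ e + C (p : ℤ) : ℤ[X]).IsPrimitive := (monic_X_pow_add_C _ he.ne').isPrimitive
  have h2 := (hprim.irreducible_iff_irreducible_map_fraction_map (K := ℚ)).mp h
  simpa using h2

/-- **The minimal polynomial of `ϖ = e^{πi/e}p^{1/e}` over `ℚ` is `X^e + p`** (so `[ℚ(ϖ) : ℚ] = e`
and `ℚ(ϖ)/ℚ` is totally ramified at `p` with uniformiser `ϖ`). [cite: SerreLocalFields1979, Ch. I §6, Prop. 17] -/
theorem minpoly_tameUnif {p : ℕ} (hp : p.Prime) {e : ℕ} (he : 0 < e) :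
    minpoly ℚ (tameUnif p e) = X ^ e + C (p : ℚ) := by
  symm
  refine minpoly.eq_of_irreducible_of_monic (irreducible_X_pow_add_C_rat hp he) ?_
    (monic_X_pow_add_C _ he.ne')
  rw [map_add, map_pow, aeval_X, aeval_C, tameUnif_pow he.ne']
  simp

/-- `1, ϖ, …, ϖ^{e−1}` are `ℚ`-linearly independent (`ℚ(ϖ) = ⊕_{i<e} ℚ ϖ^i`).
[cite: SerreLocalFields1979, Ch. I §6, Prop. 17–18] -/
theorem linearIndependent_tameUnif_pow {p : ℕ} (hp : p.Prime) {e : ℕ} (he : 0 < e) :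
    LinearIndependent ℚ (fun i : Fin e ↦ tameUnif p e ^ (i : ℕ)) := by
  have h := linearIndependent_pow (K := ℚ) (tameUnif p e)
  rw [minpoly_tameUnif hp he, natDegree_X_pow_add_C] at h
  exact h

/-- Uniqueness of the normal form: `∑_{i<e} g_i ϖ^i = 0` with `g_i ∈ ℚ` forces `g = 0`.
[cite: SerreLocalFields1979, Ch. I §6, Prop. 17–18] -/
theorem eq_zero_of_sum_mul_tameUnif_pow_eq_zero {p : ℕ} (hp : p.Prime) {e : ℕ} (he : 0 < e)
    (g : Fin e → ℚ) (h : ∑ i : Fin e, (g i : ℂ) * tameUnif p e ^ (i : ℕ) = 0) : g = 0 := by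
  have hli := linearIndependent_tameUnif_pow hp he
  rw [Fintype.linearIndependent_iff] at hli
  funext i
  refine hli g ?_ i
  rw [← h]
  exact Finset.sum_congr rfl fun i _ ↦ by rw [Rat.smul_def]

/-- **A rational number in `ϖ·O_K` is `p` times an element of `ℤ_(p)`**: if `r ∈ ℚ` and `r = ϖ·x`
with `x = ∑_{i<e} t_i ϖ^i ∈ O_K`, then `r = −p·t_{e−1}` (compare coefficients using `ϖ^e = −p` and the
linear independence of `1, …, ϖ^{e−1}`). This is `ϖ O_K ∩ ℚ = p ℤ_(p)` (total ramification).
[cite: SerreLocalFields1979, Ch. I §6, Prop. 17–18] -/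
theorem exists_eq_neg_mul_of_ratCast_eq_tameUnif_mul {p : ℕ} (hp : p.Prime) {e : ℕ} (he : 0 < e)
    (r : ℚ) {x : ℂ} (hx : IsTameIntegral p e x) (h : (r : ℂ) = tameUnif p e * x) :
    ∃ t : ℚ, 0 ≤ padicValRat p t ∧ r = -((p : ℚ) * t) := by
  obtain ⟨d, rfl⟩ : ∃ d, e = d + 1 := ⟨e - 1, (Nat.sub_add_cancel he).symm⟩
  obtain ⟨t, ht, rfl⟩ := hx
  set ϖ := tameUnif p (d + 1) with hϖ
  have hpow : ϖ ^ (d + 1) = -p := tameUnif_pow (Nat.succ_ne_zero d)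
  -- the hypothesis, expanded: `r = ∑_{i<d} t_{i} ϖ^{i+1} - p t_d`
  have h' : (r : ℂ) =
      ∑ i : Fin d, (t (Fin.castSucc i) : ℂ) * ϖ ^ ((i : ℕ) + 1) - (p : ℂ) * t (Fin.last d) := by
    rw [h, Finset.mul_sum, Fin.sum_univ_castSucc]
    have h1 : ∀ i : Fin d, ϖ * ((t (Fin.castSucc i) : ℂ) * ϖ ^ ((Fin.castSucc i : Fin (d + 1)) : ℕ)) =
        (t (Fin.castSucc i) : ℂ) * ϖ ^ ((i : ℕ) + 1) := fun i ↦ by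
      rw [Fin.val_castSucc, pow_succ]; ring
    have h2 : ϖ * ((t (Fin.last d) : ℂ) * ϖ ^ ((Fin.last d : Fin (d + 1)) : ℕ)) =
        -(p : ℂ) * t (Fin.last d) := by
      rw [Fin.val_last, ← hpow, pow_succ]; ring
    rw [Finset.sum_congr rfl fun i _ ↦ h1 i, h2]
    ring
  -- the vanishing rational combination
  let g : Fin (d + 1) → ℚ := Fin.cons (r + p * t (Fin.last d)) fun i ↦ -t (Fin.castSucc i)
  have hg : ∑ j : Fin (d + 1), (g j : ℂ) * ϖ ^ (j : ℕ) = 0 := by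
    rw [Fin.sum_univ_succ]
    simp only [g, Fin.cons_zero, Fin.cons_succ, Fin.val_zero, pow_zero, mul_one, Fin.val_succ]
    push_cast
    rw [h']
    have : ∑ i : Fin d, (-(t (Fin.castSucc i) : ℂ)) * ϖ ^ ((i : ℕ) + 1) =
        -∑ i : Fin d, (t (Fin.castSucc i) : ℂ) * ϖ ^ ((i : ℕ) + 1) := by
      rw [← Finset.sum_neg_distrib]
      exact Finset.sum_congr rfl fun i _ ↦ by ring
    rw [this]
    ring
  have hg0 := congr_fun (eq_zero_of_sum_mul_tameUnif_pow_eq_zero hp (Nat.succ_pos d) g hg) 0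
  simp only [g, Fin.cons_zero, Pi.zero_apply] at hg0
  exact ⟨t (Fin.last d), ht _, by linarith⟩

/-- **`ϖ` is not a unit of `O_K`**: `1 ≠ ϖ·x` for `x ∈ O_K` (else `1 = −p t` with `t ∈ ℤ_(p)`, i.e.
`v_p(−1/p) ≥ 0`). [cite: SerreLocalFields1979, Ch. I §6, Prop. 17–18] -/
theorem one_ne_tameUnif_mul {p : ℕ} (hp : p.Prime) {e : ℕ} (he : 0 < e) {x : ℂ}
    (hx : IsTameIntegral p e x) : (1 : ℂ) ≠ tameUnif p e * x := by
  intro h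
  obtain ⟨t, ht, h1⟩ :=
    exists_eq_neg_mul_of_ratCast_eq_tameUnif_mul hp he 1 hx (by exact_mod_cast h)
  haveI : Fact p.Prime := ⟨hp⟩
  have hp0 : (p : ℚ) ≠ 0 := by exact_mod_cast hp.ne_zero
  have htp : t = -(p : ℚ)⁻¹ := by
    field_simp
    linarith
  rw [htp, padicValRat.neg, padicValRat.inv, padicValRat.self hp.one_lt] at ht
  norm_num at ht

/-- **An integer in `ϖ·O_K` is divisible by `p`**: if `d ∈ ℕ` and `d = ϖ·x` with `x ∈ O_K` then
`p ∣ d` (`ϖ O_K ∩ ℤ = pℤ_(p) ∩ ℤ`). [cite: SerreLocalFields1979, Ch. I §6, Prop. 17–18] -/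
theorem dvd_of_natCast_eq_tameUnif_mul {p : ℕ} (hp : p.Prime) {e : ℕ} (he : 0 < e) (d : ℕ) {x : ℂ}
    (hx : IsTameIntegral p e x) (h : (d : ℂ) = tameUnif p e * x) : p ∣ d := by
  rcases Nat.eq_zero_or_pos d with rfl | hd
  · exact dvd_zero p
  obtain ⟨t, ht, h1⟩ :=
    exists_eq_neg_mul_of_ratCast_eq_tameUnif_mul hp he d hx (by exact_mod_cast h)
  haveI : Fact p.Prime := ⟨hp⟩
  have hp0 : (p : ℚ) ≠ 0 := by exact_mod_cast hp.ne_zero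
  have hd0 : (d : ℚ) ≠ 0 := by exact_mod_cast hd.ne'
  have htp : t = -((d : ℚ) / p) := by
    field_simp
    linarith
  rw [htp, padicValRat.neg, padicValRat.div hd0 hp0, padicValRat.self hp.one_lt,
    ← padicValRat_of_nat] at ht
  exact dvd_of_one_le_padicValNat (by exact_mod_cast (by linarith : (1 : ℤ) ≤ padicValNat p d))

/-- `ℤ_(p) ⊆ O_K`: a `p`-integral rational is tame-integral (`t_0 = t`, `t_i = 0` else; `e ≥ 1`).
[cite: SerreLocalFields1979, Ch. I §6, Prop. 17–18] -/
theorem IsPIntegral.isTameIntegral {p e : ℕ} (he : 0 < e) {x : ℂ} (hx : IsPIntegral p x) :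
    IsTameIntegral p e x := by
  obtain ⟨t, ht, rfl⟩ := hx
  haveI : NeZero e := ⟨he.ne'⟩
  refine ⟨Pi.single 0 t, fun i ↦ ?_, ?_⟩
  · by_cases hi : i = 0
    · subst hi; simpa using ht
    · simp [hi]
  · rw [Finset.sum_eq_single (0 : Fin e) (fun i _ hi ↦ by simp [hi]) (by simp)]
    simp

/-- `O_K` is closed under sums. [cite: SerreLocalFields1979, Ch. I §6, Prop. 17–18] -/
theorem IsTameIntegral.add {p e : ℕ} (hp : p.Prime) {x y : ℂ} (hx : IsTameIntegral p e x)
    (hy : IsTameIntegral p e y) : IsTameIntegral p e (x + y) := by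
  haveI : Fact p.Prime := ⟨hp⟩
  obtain ⟨t, ht, rfl⟩ := hx
  obtain ⟨s, hs, rfl⟩ := hy
  refine ⟨t + s, fun i ↦ ?_, ?_⟩
  · rcases eq_or_ne (t i + s i) 0 with h0 | h0
    · rw [Pi.add_apply, h0]; simp
    · exact le_trans (le_min (ht i) (hs i)) (padicValRat.min_le_padicValRat_add h0)
  · rw [← Finset.sum_add_distrib]
    exact Finset.sum_congr rfl fun i _ ↦ by rw [Pi.add_apply]; push_cast; ring

/-- `O_K` is closed under `ℤ_(p)`-scalars. [cite: SerreLocalFields1979, Ch. I §6, Prop. 17–18] -/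
theorem IsTameIntegral.ratCast_mul {p e : ℕ} (hp : p.Prime) {q : ℚ} (hq : 0 ≤ padicValRat p q)
    {x : ℂ} (hx : IsTameIntegral p e x) : IsTameIntegral p e ((q : ℂ) * x) := by
  haveI : Fact p.Prime := ⟨hp⟩
  obtain ⟨t, ht, rfl⟩ := hx
  refine ⟨fun i ↦ q * t i, fun i ↦ ?_, ?_⟩
  · rcases eq_or_ne q 0 with rfl | hq0
    · simp
    rcases eq_or_ne (t i) 0 with h0 | h0
    · simp [h0]
    · rw [padicValRat.mul hq0 h0]; exact add_nonneg hq (ht i)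
  · rw [Finset.mul_sum]
    exact Finset.sum_congr rfl fun i _ ↦ by push_cast; ring

/-- `∑` of tame integrals is tame integral. [cite: SerreLocalFields1979, Ch. I §6, Prop. 17–18] -/
theorem IsTameIntegral.sum {p e : ℕ} (hp : p.Prime) {ι : Type*} (s : Finset ι) (x : ι → ℂ)
    (hx : ∀ i ∈ s, IsTameIntegral p e (x i)) : IsTameIntegral p e (∑ i ∈ s, x i) := by
  classical
  induction s using Finset.induction_on with
  | empty => simpa using isTameIntegral_zero p e
  | insert a s ha ih =>
    rw [Finset.sum_insert ha]
    exact (hx a (Finset.mem_insert_self a s)).add hp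
      (ih fun i hi ↦ hx i (Finset.mem_insert_of_mem hi))

/-- `ϖ^m · x ∈ O_K` for `x ∈ O_K` written with ONE coefficient: `t·ϖ^m` is tame integral for
`t ∈ ℤ_(p)` and any `m` (reduce `ϖ^{e+j} = −p ϖ^j`). [cite: SerreLocalFields1979, Ch. I §6, Prop. 17–18] -/
theorem isTameIntegral_ratCast_mul_tameUnif_pow {p e : ℕ} (hp : p.Prime) (he : 0 < e) {t : ℚ}
    (ht : 0 ≤ padicValRat p t) (m : ℕ) : IsTameIntegral p e ((t : ℂ) * tameUnif p e ^ m) := by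
  haveI : Fact p.Prime := ⟨hp⟩
  induction m using Nat.strong_induction_on generalizing t with
  | _ m ih =>
    by_cases hm : m < e
    · refine ⟨Pi.single ⟨m, hm⟩ t, fun i ↦ ?_, ?_⟩
      · by_cases hi : i = ⟨m, hm⟩
        · subst hi; simpa using ht
        · simp [hi]
      · rw [Finset.sum_eq_single (⟨m, hm⟩ : Fin e) (fun i _ hi ↦ by simp [hi]) (by simp)]
        simp
    · push Not at hm
      obtain ⟨j, rfl⟩ := Nat.exists_eq_add_of_le hm
      have key : (t : ℂ) * tameUnif p e ^ (e + j) = ((-(p : ℚ) * t : ℚ) : ℂ) * tameUnif p e ^ j := by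
        rw [pow_add, tameUnif_pow he.ne']; push_cast; ring
      rw [key]
      refine ih j (by omega) ?_
      rcases eq_or_ne t 0 with rfl | ht0
      · simp
      rw [neg_mul, padicValRat.neg, padicValRat.mul (by exact_mod_cast hp.ne_zero) ht0,
        padicValRat.self hp.one_lt]
      linarith

end Scalars

/-! ### §2 `q`-expansions of `O_K·L` and primitivity of normalised forms -/

namespace TameNeronFormsAt

variable {N : ℕ} [NeZero N] {p e : ℕ} (Λ : TameNeronFormsAt N p e)

omit [NeZero N] in
/-- Fourier coefficients of a scalar multiple (the `ℂ`-linear coefficient functional `cuspCoeffₗ`).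
[cite: CesnaviciusNeururerSaha2023, §1 (p. 4)] -/
private theorem cuspCoeff_smul_form (a : ℂ) (g : CuspForm (Gamma0 N) 2) (n : ℕ) :
    cuspCoeff (a • g) n = a * cuspCoeff g n := by
  rw [← cuspCoeffₗ_apply (one_mem_strictPeriods_coe_gamma0 N) n, map_smul, smul_eq_mul,
    cuspCoeffₗ_apply]

/-- **The `q`-expansion coefficients of `O_K·L` lie in `O_K`**: for `y = ∑_{i<e} ϖ^i l_i` with
`l_i ∈ L`, `a_n(y) = ∑ ϖ^i a_n(l_i)` with `a_n(l_i) ∈ ℤ_(p)` (field `coeff_integral`).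
[cite: CesnaviciusNeururerSaha2023, §1 (p. 4) and Prop. 6.2 (p. 41)] -/
theorem isTameIntegral_cuspCoeff_of_mem_spanK (hp : p.Prime) (he : 0 < e)
    {y : CuspForm (Gamma0 N) 2} (hy : y ∈ Λ.spanK) (n : ℕ) :
    IsTameIntegral p e (cuspCoeff y n) := by
  obtain ⟨l, hl, rfl⟩ := hy
  rw [cuspCoeff_sum_smul]
  refine IsTameIntegral.sum hp _ _ fun i _ ↦ ?_
  obtain ⟨t, ht, hti⟩ := Λ.coeff_integral (l i) (hl i) n
  rw [← hti, mul_comm]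
  exact isTameIntegral_ratCast_mul_tameUnif_pow hp he ht _

/-- **Primitivity of normalised forms in `O_K·L`** (ČNS Rem. 5.16, over `O_K`): if `a₁(f) = 1` then
`f ≠ ϖ·y` for every `y ∈ O_K·L` — otherwise `1 = a₁(f) = ϖ·a₁(y)` with `a₁(y) ∈ O_K`, and `ϖ` would
be a unit of `O_K`. In particular `f ∉ ϖ L_K` (`L_K ⊆ O_K·L`).
[cite: CesnaviciusNeururerSaha2023, Rem. 5.16 (p. 40)] -/
theorem ne_tameUnif_smul_of_mem_spanK (hp : p.Prime) (he : 0 < e) {f : CuspForm (Gamma0 N) 2}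
    (hf1 : cuspCoeff f 1 = 1) {y : CuspForm (Gamma0 N) 2} (hy : y ∈ Λ.spanK) :
    f ≠ tameUnif p e • y := by
  intro h
  have h1 : (1 : ℂ) = tameUnif p e * cuspCoeff y 1 := by
    rw [← hf1, h, cuspCoeff_smul_form]
  exact one_ne_tameUnif_mul hp he (Λ.isTameIntegral_cuspCoeff_of_mem_spanK hp he hy 1) h1

/-- A normalised form is not `ϖ` times an element of `L_K`. [cite: CesnaviciusNeururerSaha2023, Rem. 5.16 (p. 40)] -/
theorem ne_tameUnif_smul_of_mem_latticeK (hp : p.Prime) (he : 0 < e) {f : CuspForm (Gamma0 N) 2}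
    (hf1 : cuspCoeff f 1 = 1) {y : CuspForm (Gamma0 N) 2} (hy : y ∈ Λ.latticeK) :
    f ≠ tameUnif p e • y :=
  Λ.ne_tameUnif_smul_of_mem_spanK hp he hf1 (Λ.latticeK_le_spanK hy)

/-- The newform of a parametrisation datum is normalised: `a₁(f) = 1`. [folklore] -/
private theorem cuspCoeff_one_f {W : WeierstrassCurve ℚ} (D : ModularParametrizationData W N) :
    cuspCoeff D.f 1 = 1 :=
  D.isNewformOf.1.2.2

/-! ### §3 The lattice kernel of LINE 38: `ϖ^n f ∈ ϖ^m L_K ⟺ m + jdeg f ≤ n`, formula (B), C1–C3 -/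

/-- **The position of `ϖ^n f` in the `ϖ`-adic filtration of `L_K`** (the cell's `Sketch38.inPow_iff`
over the carrier): for `f ∈ L` with `f ∉ ϖ L_K` (e.g. `f` normalised) and `ϖ^n f ∈ L_K`,
`ϖ^n f ∈ ϖ^m L_K ⟺ m + jdeg f ≤ n`. (→): if `m ≤ n` cancel `ϖ^m` to get `ϖ^{n−m} f ∈ L_K`, so
`jdeg f ≤ n − m`; if `m > n` cancel `ϖ^n` to get `f ∈ ϖ L_K`. (←): `ϖ^n f = ϖ^m (ϖ^{n−m} f)` with
`n − m ≥ jdeg f`. [cite: HalleNicaise2016, Part II §1.1] -/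
theorem inPowK_pow_smul_iff (hp : p.Prime) {f : CuspForm (Gamma0 N) 2} (hf : f ∈ Λ.lattice)
    (hprim : ∀ y ∈ Λ.latticeK, f ≠ tameUnif p e • y) {n : ℕ}
    (hn : tameUnif p e ^ n • f ∈ Λ.latticeK) (m : ℕ) :
    Λ.InPowK (tameUnif p e ^ n • f) m ↔ m + Λ.jdeg hf ≤ n := by
  have hϖ : tameUnif p e ≠ 0 := tameUnif_ne_zero e hp.ne_zero
  have hdn : Λ.jdeg hf ≤ n := Λ.jdeg_le_of_mem hf hn
  constructor
  · rintro ⟨y, hy, hxy⟩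
    by_contra hlt
    push Not at hlt
    by_cases hmn : m ≤ n
    · have hsplit : tameUnif p e ^ n • f = tameUnif p e ^ m • (tameUnif p e ^ (n - m) • f) := by
        rw [← mul_smul, ← pow_add, Nat.add_sub_cancel' hmn]
      have hcancel : tameUnif p e ^ (n - m) • f = y :=
        smul_right_injective (CuspForm (Gamma0 N) 2) (pow_ne_zero m hϖ) (by simp only; rw [← hsplit, hxy])
      have hle := Λ.jdeg_le_of_mem hf (j := n - m) (by rw [hcancel]; exact hy)
      omega
    · push Not at hmn
      have hsplit : tameUnif p e ^ m • y =
          tameUnif p e ^ n • (tameUnif p e • (tameUnif p e ^ (m - n - 1) • y)) := by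
        rw [← mul_smul, ← mul_smul, ← pow_succ, ← pow_add]
        congr 2
        omega
      have hcancel : f = tameUnif p e • (tameUnif p e ^ (m - n - 1) • y) :=
        smul_right_injective (CuspForm (Gamma0 N) 2) (pow_ne_zero n hϖ) (by simp only; rw [hxy, hsplit])
      exact hprim _ (Λ.tameUnif_pow_smul_memK hy _) hcancel
  · intro hle
    refine ⟨tameUnif p e ^ (n - m) • f, Λ.pow_smul_memK_of_jdeg_le hf (by omega), ?_⟩
    rw [← mul_smul, ← pow_add, Nat.add_sub_cancel' (by omega : m ≤ n)]

/-- `ϖ^m L_K` is stable under a `p`-adic unit of `ℤ`: for `u ∈ ℤ` with `p ∤ u`,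
`u·z ∈ ϖ^m L_K ⟺ z ∈ ϖ^m L_K` (`L_K` is a `ℤ_(p)`-module). [cite: HalleNicaise2016, Part II §1.2] -/
theorem inPowK_intCast_smul_iff {u : ℤ} (hu : ¬ (p : ℤ) ∣ u) (z : CuspForm (Gamma0 N) 2) (m : ℕ) :
    Λ.InPowK ((u : ℂ) • z) m ↔ Λ.InPowK z m := by
  have hu0 : (u : ℂ) ≠ 0 := by
    have : u ≠ 0 := fun h ↦ hu (h ▸ dvd_zero _)
    exact_mod_cast this
  have hun : ¬ p ∣ u.natAbs := fun h ↦ hu (Int.natCast_dvd.mpr h)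
  -- `u⁻¹ • y ∈ L_K` for `y ∈ L_K`: `u⁻¹ = sign(u) · |u|⁻¹`
  have hinv : ∀ y ∈ Λ.latticeK, ((u : ℂ)⁻¹) • y ∈ Λ.latticeK := by
    intro y hy
    have habs : ((u.natAbs : ℂ)⁻¹) • y ∈ Λ.latticeK := Λ.inv_smul_memK y hy u.natAbs hun
    have hcast : (u.natAbs : ℂ) = ((u.natAbs : ℤ) : ℂ) := (Int.cast_natCast _).symm
    rcases Int.natAbs_eq u with h | h
    · have : (u : ℂ) = (u.natAbs : ℂ) := by rw [hcast, ← h]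
      rwa [this]
    · have : (u : ℂ) = -(u.natAbs : ℂ) := by rw [hcast, ← Int.cast_neg, ← h]
      rw [this, inv_neg, _root_.neg_smul]
      exact Λ.latticeK.neg_mem habs
  constructor
  · rintro ⟨y, hy, hxy⟩
    refine ⟨((u : ℂ)⁻¹) • y, hinv y hy, ?_⟩
    rw [smul_comm, ← hxy, ← mul_smul, inv_mul_cancel₀ hu0, one_smul]
  · rintro ⟨y, hy, rfl⟩
    refine ⟨(u : ℂ) • y, ?_, by rw [smul_comm]⟩
    rw [Int.cast_smul_eq_zsmul]
    exact Λ.latticeK.smul_mem u hy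

/-- The decomposition `c = p^k · c'` with `k = v_p(c)`, `p ∤ c'`, and `ϖ^a c = (−1)^k c' ϖ^{a + ek}` in `ℂ`
(`p = −ϖ^e`). [cite: SerreLocalFields1979, Ch. I §6, Prop. 17] -/
private theorem tameUnif_pow_mul_intCast_eq (hp : p.Prime) (he : 0 < e) {c : ℤ} (hc : c ≠ 0) (a : ℕ) :
    ∃ c' : ℤ, ¬ (p : ℤ) ∣ c' ∧ c = (p : ℤ) ^ padicValInt p c * c' ∧
      tameUnif p e ^ a * (c : ℂ) =
        (((-1 : ℤ) ^ padicValInt p c * c' : ℤ) : ℂ) * tameUnif p e ^ (a + e * padicValInt p c) := by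
  haveI : Fact p.Prime := ⟨hp⟩
  set k := padicValInt p c with hk
  obtain ⟨c', hc'⟩ : (p : ℤ) ^ k ∣ c := padicValInt_dvd c
  refine ⟨c', fun hdvd ↦ ?_, hc', ?_⟩
  · have h1 : (p : ℤ) ^ (k + 1) ∣ c := by
      rw [hc', pow_succ]
      exact mul_dvd_mul_left _ hdvd
    rcases (padicValInt_dvd_iff (k + 1) c).mp h1 with h | h
    · exact hc h
    · omega
  · have hpϖ : (p : ℂ) = -tameUnif p e ^ e := by rw [tameUnif_pow he.ne', neg_neg]
    conv_lhs => rw [hc']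
    push_cast
    rw [hpϖ, pow_add, pow_mul]
    ring

/-- **Formula (B) of LINE 38, lattice form.** For a parametrisation datum `D` (normalised newform
`f = D.f ∈ L`, Manin constant `c ≠ 0`) and an exponent `a` with `ϖ^a c f ∈ L_K`:
`tameColength D a + jdeg f = a + e·v_p(c)`. Proof: `ϖ^a c = u·ϖ^{a + e v_p(c)}` with `u ∈ ℤ`,
`p ∤ u`; by `inPowK_pow_smul_iff` the set `{m : ϖ^a c f ∈ ϖ^m L_K}` is `{m : m + jdeg f ≤ a + e v_p(c)}`,
whose supremum is `a + e v_p(c) − jdeg f`. At the true lattices with `a` the Néron exponent this is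
`e·v_p(c) = col_K + jdeg − a`, Edixhoven's `v_p(c) = (v_C(φ^*ω_U) − a)/n` made model-free.
[cite: EdixhovenManin1991, §4 (the formula for v_p(c))] [cite: HalleNicaise2016, Part II §1.1] -/
theorem tameColength_add_jdeg_eq (hp : p.Prime) (he : 0 < e) {W : WeierstrassCurve ℚ}
    (D : ModularParametrizationData W N) (a : ℕ)
    (hx : (tameUnif p e ^ a * (D.maninConstant : ℂ)) • D.f ∈ Λ.latticeK) :
    Λ.tameColength D a + Λ.jdeg (Λ.f_mem D) = a + e * padicValInt p D.maninConstant := by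
  set k := padicValInt p D.maninConstant with hk
  obtain ⟨c', hc', -, hprod⟩ :=
    tameUnif_pow_mul_intCast_eq hp he (ModularParametrizationData.maninConstant_ne_zero_holds D) a
  have hu : ¬ (p : ℤ) ∣ (-1 : ℤ) ^ k * c' := by
    intro h
    rcases (Int.Prime.dvd_mul' hp h) with h1 | h1
    · have := Int.Prime.dvd_pow' hp h1
      have hp1 : (p : ℤ) ∣ 1 := (dvd_neg.mpr this : (p : ℤ) ∣ -(-1)) |>.trans (by simp)
      exact hp.ne_one (by exact_mod_cast Int.eq_one_of_dvd_one (by positivity) hp1)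
    · exact hc' h1
  have hprim := fun y hy ↦ Λ.ne_tameUnif_smul_of_mem_latticeK hp he (cuspCoeff_one_f D) (y := y) hy
  -- rewrite the element and the membership hypothesis
  have hxeq : (tameUnif p e ^ a * (D.maninConstant : ℂ)) • D.f =
      (((-1 : ℤ) ^ k * c' : ℤ) : ℂ) • (tameUnif p e ^ (a + e * k) • D.f) := by
    rw [← mul_smul, ← hprod]
  have hn : tameUnif p e ^ (a + e * k) • D.f ∈ Λ.latticeK := by
    have := (Λ.inPowK_zero_iff _).2 hx
    rw [hxeq, Λ.inPowK_intCast_smul_iff hu] at this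
    exact (Λ.inPowK_zero_iff _).1 this
  have hset : {m : ℕ | Λ.InPowK ((tameUnif p e ^ a * (D.maninConstant : ℂ)) • D.f) m} =
      Set.Iic (a + e * k - Λ.jdeg (Λ.f_mem D)) := by
    ext m
    rw [Set.mem_setOf_eq, hxeq, Λ.inPowK_intCast_smul_iff hu, Λ.inPowK_pow_smul_iff hp (Λ.f_mem D) hprim hn,
      Set.mem_Iic]
    have := Λ.jdeg_le_of_mem (Λ.f_mem D) hn
    omega
  have hdn : Λ.jdeg (Λ.f_mem D) ≤ a + e * k := Λ.jdeg_le_of_mem (Λ.f_mem D) hn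
  unfold tameColength
  rw [hset, csSup_Iic]
  omega

/-- Formula (B) under the geometric hypothesis: if `W` acquires good reduction over `K` with Néron
exponent `a` (`HasTameGoodModel p e W a`) and `D` is lattice-optimal, then `ϖ^a c f = π^*ω_{W,K} ∈ L_K`
(field `tame_smul_memK`) and `tameColength D a + jdeg f = a + e·v_p(c)`.
[cite: EdixhovenManin1991, §4] [cite: BoschLutkebohmertRaynaud1990, Def. 1.2/1] -/
theorem tameColength_add_jdeg_eq_of_hasTameGoodModel (hp : p.Prime) (he : 0 < e)
    {W : WeierstrassCurve ℚ} [W.IsElliptic] [W.IsGloballyMinimal] (D : ModularParametrizationData W N)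
    (hopt : ∀ z ∈ D.L.lattice, ∃ w ∈ periodLattice D.f, z = D.c * w) {a : ℕ}
    (ha : HasTameGoodModel p e W a) :
    Λ.tameColength D a + Λ.jdeg (Λ.f_mem D) = a + e * padicValInt p D.maninConstant :=
  Λ.tameColength_add_jdeg_eq hp he D a (Λ.tame_smul_memK W D hopt a ha)

/-- **(C1) «Manin `p`-unit ⟺ tame colength bound».** With `ϖ^a c f ∈ L_K`:
`p ∤ c ⟺ tameColength D a ≤ a` (from (B) and `jdeg f ≤ e − 1 < e`). For the route: on a Kodaira-III
row (`a = 2`, `e = 8`) `3 ∤ c ⟺ col_K ≤ 2`; on a III* row (`a = 6`) `3 ∤ c ⟺ col_K ≤ 6`.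
[cite: EdixhovenManin1991, §4 Prop. 8] -/
theorem not_dvd_maninConstant_iff_tameColength_le (hp : p.Prime) (he : 0 < e)
    {W : WeierstrassCurve ℚ} (D : ModularParametrizationData W N) (a : ℕ)
    (hx : (tameUnif p e ^ a * (D.maninConstant : ℂ)) • D.f ∈ Λ.latticeK) :
    ¬ (p : ℤ) ∣ D.maninConstant ↔ Λ.tameColength D a ≤ a := by
  haveI : Fact p.Prime := ⟨hp⟩
  have hB := Λ.tameColength_add_jdeg_eq hp he D a hx
  have hj : Λ.jdeg (Λ.f_mem D) ≤ e - 1 := Λ.jdeg_le (Λ.f_mem D)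
  have hc0 := ModularParametrizationData.maninConstant_ne_zero_holds D
  have hk : ¬ (p : ℤ) ∣ D.maninConstant ↔ padicValInt p D.maninConstant = 0 := by
    refine ⟨padicValInt.eq_zero_of_not_dvd, fun h0 hdvd ↦ ?_⟩
    rcases (padicValInt_dvd_iff 1 D.maninConstant).mp (by rwa [pow_one]) with h | h
    · exact hc0 h
    · omega
  rw [hk]
  constructor
  · intro h0; rw [h0] at hB; omega
  · intro hle
    by_contra hk0
    have : 1 ≤ padicValInt p D.maninConstant := Nat.one_le_iff_ne_zero.mpr hk0
    have : e ≤ e * padicValInt p D.maninConstant := Nat.le_mul_of_pos_right e this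
    omega

/-- (C1) under the geometric hypothesis: for a lattice-optimal datum `D` of a globally minimal `W`
acquiring good reduction over `K` with Néron exponent `a`, `p ∤ c ⟺ tameColength D a ≤ a` — the form
in which the route's organ (`3 ∤ c` on a Kodaira-III row, `a = 2`, `e = 8`) becomes the colength bound
«`col_K(III) ≤ 2`» of LINE 38's item N38d. [cite: EdixhovenManin1991, §4 Prop. 8] -/
theorem not_dvd_maninConstant_iff_tameColength_le_of_hasTameGoodModel (hp : p.Prime) (he : 0 < e)
    {W : WeierstrassCurve ℚ} [W.IsElliptic] [W.IsGloballyMinimal] (D : ModularParametrizationData W N)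
    (hopt : ∀ z ∈ D.L.lattice, ∃ w ∈ periodLattice D.f, z = D.c * w) {a : ℕ}
    (ha : HasTameGoodModel p e W a) :
    ¬ (p : ℤ) ∣ D.maninConstant ↔ Λ.tameColength D a ≤ a :=
  Λ.not_dvd_maninConstant_iff_tameColength_le hp he D a (Λ.tame_smul_memK W D hopt a ha)

/-- **(C2) «model-free Edixhoven Prop. 8».** With `ϖ^a c f ∈ L_K`: if `tameColength D a = 0` (at the
true lattices: `𝒥_K → ℰ_K` is smooth, "`φ` Lie-surjective over `O_K`") then `p ∤ c` and
`jdeg f = a`. [cite: EdixhovenManin1991, §4 Prop. 8] -/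
theorem not_dvd_and_jdeg_eq_of_tameColength_eq_zero (hp : p.Prime) (he : 0 < e)
    {W : WeierstrassCurve ℚ} (D : ModularParametrizationData W N) (a : ℕ)
    (hx : (tameUnif p e ^ a * (D.maninConstant : ℂ)) • D.f ∈ Λ.latticeK)
    (h0 : Λ.tameColength D a = 0) :
    ¬ (p : ℤ) ∣ D.maninConstant ∧ Λ.jdeg (Λ.f_mem D) = a := by
  haveI : Fact p.Prime := ⟨hp⟩
  have hB := Λ.tameColength_add_jdeg_eq hp he D a hx
  have hj : Λ.jdeg (Λ.f_mem D) ≤ e - 1 := Λ.jdeg_le (Λ.f_mem D)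
  have hunit : ¬ (p : ℤ) ∣ D.maninConstant :=
    (Λ.not_dvd_maninConstant_iff_tameColength_le hp he D a hx).2 (by omega)
  refine ⟨hunit, ?_⟩
  rw [padicValInt.eq_zero_of_not_dvd hunit, h0] at hB
  omega

/-- **(C3) «the ČNS half re-derived over `O_K`».** For a lattice-optimal datum `D` of a globally
minimal `W` acquiring good reduction over `K` with exponent `a`: if `p ∤ deg φ` then
`tameColength D a = 0`. Proof: if `ϖ^a c f = ϖ·y` with `y ∈ L_K`, the field
`tame_pullback_integralK` at `g = y` gives `deg φ·⟨f, y⟩ = ϖ^a x c ⟨f, f⟩` with `x ∈ O_K`, while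
`ϖ⟨f, y⟩ = ϖ^a c ⟨f, f⟩`; as `⟨f, f⟩ ≠ 0` (positivity) this says `deg φ = ϖ·x ∈ ϖ O_K ∩ ℤ`, so
`p ∣ deg φ`. (At the true lattices: `π ∘ π^∨ = [deg φ]` a unit on `Lie ℰ_K` forces `Lie π` onto.)
[cite: CesnaviciusNeururerSaha2023, Lemma 7.1 and Thm. 7.2 (pp. 46–47)] -/
theorem tameColength_eq_zero_of_not_dvd_modularDegree (hp : p.Prime) (he : 0 < e)
    {W : WeierstrassCurve ℚ} [W.IsElliptic] [W.IsGloballyMinimal] (D : ModularParametrizationData W N)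
    (hopt : ∀ z ∈ D.L.lattice, ∃ w ∈ periodLattice D.f, z = D.c * w) {a : ℕ}
    (ha : HasTameGoodModel p e W a) (hdeg : ¬ p ∣ D.modularDegree) :
    Λ.tameColength D a = 0 := by
  by_contra h0
  have hx := Λ.tame_smul_memK W D hopt a ha
  -- `tameColength ≥ 1` gives `ϖ^a c f ∈ ϖ L_K`
  have hB := Λ.tameColength_add_jdeg_eq hp he D a hx
  set k := padicValInt p D.maninConstant
  obtain ⟨c', hc', -, hprod⟩ :=
    tameUnif_pow_mul_intCast_eq hp he (ModularParametrizationData.maninConstant_ne_zero_holds D) a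
  have h1 : Λ.InPowK ((tameUnif p e ^ a * (D.maninConstant : ℂ)) • D.f) 1 := by
    have hmem : Λ.tameColength D a ∈
        {m : ℕ | Λ.InPowK ((tameUnif p e ^ a * (D.maninConstant : ℂ)) • D.f) m} := by
      apply Nat.sSup_mem ⟨0, (Λ.inPowK_zero_iff _).2 hx⟩
      refine ⟨a + e * k, fun m hm ↦ ?_⟩
      -- bounded: membership forces `m ≤ a + e k` via (B)'s characterisation
      have hu : ¬ (p : ℤ) ∣ (-1 : ℤ) ^ k * c' := by
        intro h
        rcases (Int.Prime.dvd_mul' hp h) with h1 | h1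
        · have := Int.Prime.dvd_pow' hp h1
          have hp1 : (p : ℤ) ∣ 1 := (dvd_neg.mpr this : (p : ℤ) ∣ -(-1)) |>.trans (by simp)
          exact hp.ne_one (by exact_mod_cast Int.eq_one_of_dvd_one (by positivity) hp1)
        · exact hc' h1
      have hxeq : (tameUnif p e ^ a * (D.maninConstant : ℂ)) • D.f =
          (((-1 : ℤ) ^ k * c' : ℤ) : ℂ) • (tameUnif p e ^ (a + e * k) • D.f) := by
        rw [← mul_smul, ← hprod]
      have hn : tameUnif p e ^ (a + e * k) • D.f ∈ Λ.latticeK := by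
        have := (Λ.inPowK_zero_iff _).2 hx
        rw [hxeq, Λ.inPowK_intCast_smul_iff hu] at this
        exact (Λ.inPowK_zero_iff _).1 this
      have hprim := fun y hy ↦
        Λ.ne_tameUnif_smul_of_mem_latticeK hp he (cuspCoeff_one_f D) (y := y) hy
      rw [Set.mem_setOf_eq, hxeq, Λ.inPowK_intCast_smul_iff hu,
        Λ.inPowK_pow_smul_iff hp (Λ.f_mem D) hprim hn] at hm
      omega
    exact InPowK.of_le Λ (Nat.one_le_iff_ne_zero.mpr h0) hmem
  obtain ⟨y, hy, hxy⟩ := h1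
  rw [pow_one] at hxy
  -- apply the pull-back integrality over `O_K` to `y`
  obtain ⟨x, hxO, hpull⟩ := Λ.tame_pullback_integralK W D hopt a ha y hy
  have hff : peterssonProduct (Gamma0 N) 2 D.f D.f ≠ 0 := by
    intro h
    have hpos := peterssonProduct_self_pos_holds (Gamma0 N) 2
      (IsNormalized.ne_zero D.isNewformOf.1.2.2)
    rw [h, Complex.zero_re] at hpos
    exact lt_irrefl _ hpos
  have hϖ : tameUnif p e ≠ 0 := tameUnif_ne_zero e hp.ne_zero
  have hc0 : (D.maninConstant : ℂ) ≠ 0 := by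
    exact_mod_cast ModularParametrizationData.maninConstant_ne_zero_holds D
  -- `⟨f, ϖ^a c f⟩ = ϖ ⟨f, y⟩`
  have hfy : tameUnif p e * peterssonProduct (Gamma0 N) 2 D.f y =
      tameUnif p e ^ a * (D.maninConstant : ℂ) * peterssonProduct (Gamma0 N) 2 D.f D.f := by
    rw [← peterssonProduct_smul_right, ← hxy, peterssonProduct_smul_right]
  have key : (D.modularDegree : ℂ) = tameUnif p e * x := by
    have h2 : tameUnif p e * ((D.modularDegree : ℂ) * peterssonProduct (Gamma0 N) 2 D.f y) =
        tameUnif p e * (tameUnif p e ^ a * x * (D.maninConstant : ℂ) *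
          peterssonProduct (Gamma0 N) 2 D.f D.f) := by rw [hpull]
    have h3 : (D.modularDegree : ℂ) * (tameUnif p e ^ a * (D.maninConstant : ℂ) *
        peterssonProduct (Gamma0 N) 2 D.f D.f) =
        (tameUnif p e * x) * (tameUnif p e ^ a * (D.maninConstant : ℂ) *
          peterssonProduct (Gamma0 N) 2 D.f D.f) := by
      calc (D.modularDegree : ℂ) * (tameUnif p e ^ a * (D.maninConstant : ℂ) *
              peterssonProduct (Gamma0 N) 2 D.f D.f)
          = tameUnif p e * ((D.modularDegree : ℂ) * peterssonProduct (Gamma0 N) 2 D.f y) := by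
            rw [← hfy]; ring
        _ = tameUnif p e * (tameUnif p e ^ a * x * (D.maninConstant : ℂ) *
              peterssonProduct (Gamma0 N) 2 D.f D.f) := h2
        _ = (tameUnif p e * x) * (tameUnif p e ^ a * (D.maninConstant : ℂ) *
              peterssonProduct (Gamma0 N) 2 D.f D.f) := by ring
    exact mul_right_cancel₀ (mul_ne_zero (mul_ne_zero (pow_ne_zero a hϖ) hc0) hff) h3
  exact hdeg (dvd_of_natCast_eq_tameUnif_mul hp he D.modularDegree hxO key)

include Λ in
/-- **ČNS Thm. 1.2 at `p` from the carrier** (the non-vacuity witness of the HONESTY audit): for a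
lattice-optimal datum `D` of a globally minimal `W`, `v_p(c) ≤ v_p(deg φ)`. From `f ∈ L`
(`mem_of_span_newforms`) and `pullback_integral` at `g = f`: `deg φ·⟨f, f⟩ = t·c·⟨f, f⟩` with
`t ∈ ℤ_(p)`, and `⟨f, f⟩ ≠ 0`. [cite: CesnaviciusNeururerSaha2023, Thm. 1.2 and Thm. 7.2 (p. 47)] -/
theorem padicValInt_maninConstant_le_padicValNat_modularDegree (hp : p.Prime)
    {W : WeierstrassCurve ℚ} [W.IsElliptic] [W.IsGloballyMinimal] (D : ModularParametrizationData W N)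
    (hopt : ∀ z ∈ D.L.lattice, ∃ w ∈ periodLattice D.f, z = D.c * w) :
    padicValInt p D.maninConstant ≤ padicValNat p D.modularDegree := by
  haveI : Fact p.Prime := ⟨hp⟩
  obtain ⟨t, ht, hpull⟩ := Λ.pullback_integral_self D hopt
  have hff : peterssonProduct (Gamma0 N) 2 D.f D.f ≠ 0 := by
    intro h
    have hpos := peterssonProduct_self_pos_holds (Gamma0 N) 2
      (IsNormalized.ne_zero D.isNewformOf.1.2.2)
    rw [h, Complex.zero_re] at hpos
    exact lt_irrefl _ hpos
  have hdeg : (D.modularDegree : ℂ) = (t : ℂ) * (D.maninConstant : ℂ) :=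
    mul_right_cancel₀ hff (by rw [hpull])
  have hdegQ : (D.modularDegree : ℚ) = t * D.maninConstant := by exact_mod_cast hdeg
  have hd0 : (D.modularDegree : ℚ) ≠ 0 := by exact_mod_cast D.deg_pos.ne'
  have hc0 : (D.maninConstant : ℚ) ≠ 0 := by
    exact_mod_cast ModularParametrizationData.maninConstant_ne_zero_holds D
  have ht0 : t ≠ 0 := by
    intro h; rw [h, zero_mul] at hdegQ; exact hd0 hdegQ
  have hv : padicValRat p (D.modularDegree : ℚ) = padicValRat p t + padicValRat p D.maninConstant := by
    rw [hdegQ, padicValRat.mul ht0 hc0]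
  rw [← padicValRat_of_nat, padicValRat.of_int] at hv
  have : (padicValInt p D.maninConstant : ℤ) ≤ padicValNat p D.modularDegree := by linarith
  exact_mod_cast this

end TameNeronFormsAt

/-! ### §4 A worked instance: `HasTameGoodModel 3 8 W 2` for short Weierstrass models of type III at `3` -/

section Instance

/-- `v₃(4) = 0`. [folklore] -/
private theorem padicValRat_three_four : padicValRat 3 (4 : ℚ) = 0 := by
  rw [show (4 : ℚ) = ((4 : ℕ) : ℚ) by norm_num, padicValRat.of_nat, Nat.cast_eq_zero]
  exact padicValNat.eq_zero_of_not_dvd (by norm_num)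

/-- `v₃(3^k) = k`. [folklore] -/
private theorem padicValRat_three_pow (k : ℕ) : padicValRat 3 ((3 : ℚ) ^ k) = k := by
  haveI : Fact (Nat.Prime 3) := ⟨Nat.prime_three⟩
  rw [padicValRat.pow, show (3 : ℚ) = ((3 : ℕ) : ℚ) by norm_num, padicValRat.self (by norm_num)]
  simp

/-- **`HasTameGoodModel` is inhabited on the Kodaira-III short models at `3`** (a worked instance of the
`K`-side hypothesis of `TameNeronFormsAt`, `(p, e, a) = (3, 8, 2)`): for `W : y² = x³ + Ax + B` with
`A, B ∈ ℤ`, `v₃(A) = 1`, `9 ∣ B` (Tate's algorithm: additive, `3² ∣ a₆`, `3³ ∤ b₈ = −A²`, i.e. type III at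
`3`; `v₃(Δ) = 3`), the change of variables `(u, r, s, t) = (ϖ², 0, 0, 0)`, `ϖ⁸ = −3`, yields
`a₁' = a₂' = a₃' = 0`, `a₄' = −A/3`, `a₆' = B'·ϖ⁴` (`B = 9B'`), `Δ' = 16(4A³ + 27B²)/27`, all in
`O_K = ℤ_(3)[ϖ]` with `Δ'` a unit (`v₃(4A³ + 27B²) = 3`): `W` acquires good reduction over `K = ℚ(ϖ)` with
Néron exponent `a = 2 = e·v₃(Δ)/12`. (The III* analogue — `v₃(A) = 3`, `3⁵ ∣ B`, `u = ϖ⁶`, `a = 6` — is the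
same computation; `TODO(general form)`: arbitrary minimal models of type III/III* at `3`.)
[cite: SilvermanAEC2009, III §1 Table 3.1; VII.1 Prop. 1.3 (d), Remark 1.1]
[cite: SilvermanATAEC1994, IV §9 (Tate's algorithm, Steps 1–4: type III)] -/
theorem hasTameGoodModel_three_eight_two_of_short (A B : ℤ) (hA : padicValInt 3 A = 1)
    (hB : (9 : ℤ) ∣ B) : HasTameGoodModel 3 8 (⟨0, 0, 0, A, B⟩ : WeierstrassCurve ℚ) 2 := by
  haveI : Fact (Nat.Prime 3) := ⟨Nat.prime_three⟩
  have hϖ : tameUnif 3 8 ≠ 0 := tameUnif_ne_zero 8 (by norm_num)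
  have h8 : tameUnif 3 8 ^ 8 = -3 := by
    have := tameUnif_pow (p := 3) (e := 8) (by norm_num); exact_mod_cast this
  -- arithmetic of A, B: v₃(4A³ + 27B²) = 3
  have hA0 : A ≠ 0 := by
    rintro rfl; simp [padicValInt] at hA
  have hAQ : (A : ℚ) ≠ 0 := by exact_mod_cast hA0
  have hvA : padicValRat 3 (A : ℚ) = 1 := by rw [padicValRat.of_int]; exact_mod_cast hA
  obtain ⟨B', rfl⟩ := hB
  have hv4A : padicValRat 3 (4 * (A : ℚ) ^ 3) = 3 := by
    rw [padicValRat.mul (by norm_num) (pow_ne_zero 3 hAQ), padicValRat.pow, hvA, padicValRat_three_four]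
    norm_num
  set S : ℚ := 4 * (A : ℚ) ^ 3 + 27 * ((9 * B' : ℤ) : ℚ) ^ 2 with hS
  have hSv : padicValRat 3 S = 3 ∧ S ≠ 0 := by
    rcases eq_or_ne B' 0 with rfl | hB0
    · have hS' : S = 4 * (A : ℚ) ^ 3 := by rw [hS]; push_cast; ring
      rw [hS']
      exact ⟨hv4A, mul_ne_zero (by norm_num) (pow_ne_zero 3 hAQ)⟩
    · have hB'Q : ((9 * B' : ℤ) : ℚ) ≠ 0 := by exact_mod_cast mul_ne_zero (by norm_num) hB0
      have hv27 : 7 ≤ padicValRat 3 (27 * ((9 * B' : ℤ) : ℚ) ^ 2) := by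
        rw [padicValRat.mul (by norm_num) (pow_ne_zero 2 hB'Q), padicValRat.pow,
          show (27 : ℚ) = (3 : ℚ) ^ 3 by norm_num, padicValRat_three_pow]
        have h9B : 2 ≤ padicValRat 3 ((9 * B' : ℤ) : ℚ) := by
          push_cast
          rw [padicValRat.mul (by norm_num) (by exact_mod_cast hB0), show (9 : ℚ) = (3 : ℚ) ^ 2 by norm_num,
            padicValRat_three_pow, padicValRat.of_int]
          have : (0 : ℤ) ≤ padicValInt 3 B' := by positivity
          push_cast
          linarith
        push_cast at h9B ⊢
        linarith
      have hne : padicValRat 3 (4 * (A : ℚ) ^ 3) ≠ padicValRat 3 (27 * ((9 * B' : ℤ) : ℚ) ^ 2) := by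
        rw [hv4A]; intro h; linarith
      have hS0 : S ≠ 0 := by
        intro h0
        have h' : 4 * (A : ℚ) ^ 3 = -(27 * ((9 * B' : ℤ) : ℚ) ^ 2) := by linarith
        apply hne
        rw [h', padicValRat.neg]
      refine ⟨?_, hS0⟩
      rw [padicValRat.add_eq_min hS0 (mul_ne_zero (by norm_num) (pow_ne_zero 3 hAQ))
        (mul_ne_zero (by norm_num) (pow_ne_zero 2 hB'Q)) hne, hv4A]
      exact min_eq_left (by linarith)
  -- the change of variables `(ϖ², 0, 0, 0)` and the model
  set ϖ := tameUnif 3 8 with hϖdef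
  set C : WeierstrassCurve.VariableChange ℂ := ⟨Units.mk0 (ϖ ^ 2) (pow_ne_zero 2 hϖ), 0, 0, 0⟩ with hC
  set W : WeierstrassCurve ℚ := ⟨0, 0, 0, (A : ℚ), ((9 * B' : ℤ) : ℚ)⟩ with hW
  have hu : ((C.u⁻¹ : ℂˣ) : ℂ) = (ϖ ^ 2)⁻¹ := by
    rw [Units.val_inv_eq_inv_val, hC, Units.val_mk0]
  have hWΔ : W.Δ = -16 * S := by
    simp only [hW, hS, WeierstrassCurve.Δ, WeierstrassCurve.b₂, WeierstrassCurve.b₄,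
      WeierstrassCurve.b₆, WeierstrassCurve.b₈]
    ring
  have h16 : (ϖ ^ 2)⁻¹ ^ 4 = ((-3 : ℂ))⁻¹ := by
    rw [inv_pow, ← pow_mul, show 2 * 4 = 8 by norm_num, h8]
  have h24 : (ϖ ^ 2)⁻¹ ^ 12 = ((-27 : ℂ))⁻¹ := by
    rw [inv_pow, ← pow_mul, show 2 * 12 = 8 * 3 by norm_num, pow_mul, h8]; norm_num
  have h12 : (ϖ ^ 2)⁻¹ ^ 6 = ϖ ^ 4 / 9 := by
    have h16' : ϖ ^ 16 = 9 := by rw [show 16 = 8 * 2 by norm_num, pow_mul, h8]; norm_num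
    rw [inv_pow, ← pow_mul, show 2 * 6 = 12 by norm_num, eq_div_iff (by norm_num : (9 : ℂ) ≠ 0),
      ← h16', show (16 : ℕ) = 4 + 12 by norm_num, pow_add, ← mul_assoc, mul_comm ((ϖ ^ 12)⁻¹) (ϖ ^ 4),
      mul_assoc, inv_mul_cancel₀ (pow_ne_zero 12 hϖ), mul_one]
  -- the five coefficients and the discriminant of the transformed model
  have hbc : W.baseChange ℂ = ⟨0, 0, 0, (A : ℂ), ((9 * B' : ℤ) : ℂ)⟩ := by
    rw [hW]; ext <;> simp [WeierstrassCurve.baseChange, WeierstrassCurve.map]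
  have ha₁ : (C • W.baseChange ℂ).a₁ = 0 := by
    rw [WeierstrassCurve.variableChange_a₁, hbc, hC]; simp
  have ha₂ : (C • W.baseChange ℂ).a₂ = 0 := by
    rw [WeierstrassCurve.variableChange_a₂, hbc, hC]; simp
  have ha₃ : (C • W.baseChange ℂ).a₃ = 0 := by
    rw [WeierstrassCurve.variableChange_a₃, hbc, hC]; simp
  have ha₄ : (C • W.baseChange ℂ).a₄ = (((-A : ℚ) / 3 : ℚ) : ℂ) := by
    rw [WeierstrassCurve.variableChange_a₄, hu, h16, hbc, hC]
    push_cast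
    simp
    field_simp
  have ha₆ : (C • W.baseChange ℂ).a₆ = ((B' : ℚ) : ℂ) * ϖ ^ 4 := by
    rw [WeierstrassCurve.variableChange_a₆, hu, h12, hbc, hC]
    push_cast
    simp
    field_simp
  have hΔ : (C • W.baseChange ℂ).Δ = ((16 * S / 27 : ℚ) : ℂ) := by
    rw [WeierstrassCurve.variableChange_Δ, hu, h24, hbc, hS]
    simp only [WeierstrassCurve.Δ, WeierstrassCurve.b₂, WeierstrassCurve.b₄, WeierstrassCurve.b₆,
      WeierstrassCurve.b₈]
    push_cast
    field_simp
    ring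
  -- valuations of the witnesses
  have hv16 : padicValRat 3 (16 : ℚ) = 0 := by
    rw [show (16 : ℚ) = ((16 : ℕ) : ℚ) by norm_num, padicValRat.of_nat, Nat.cast_eq_zero]
    exact padicValNat.eq_zero_of_not_dvd (by norm_num)
  have hva₄ : IsTameIntegral 3 8 ((((-A : ℚ) / 3 : ℚ) : ℂ)) := by
    refine IsPIntegral.isTameIntegral (by norm_num) ⟨(-A : ℚ) / 3, ?_, rfl⟩
    rw [padicValRat.div (neg_ne_zero.mpr hAQ) (by norm_num), padicValRat.neg, hvA,
      show (3 : ℚ) = ((3 : ℕ) : ℚ) by norm_num, padicValRat.self (by norm_num)]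
    norm_num
  have hva₆ : IsTameIntegral 3 8 (((B' : ℚ) : ℂ) * ϖ ^ 4) := by
    refine isTameIntegral_ratCast_mul_tameUnif_pow Nat.prime_three (by norm_num) ?_ 4
    rw [padicValRat.of_int]
    positivity
  have hvy : IsTameIntegral 3 8 (((27 / (16 * S) : ℚ) : ℂ)) := by
    refine IsPIntegral.isTameIntegral (by norm_num) ⟨27 / (16 * S), ?_, rfl⟩
    rw [padicValRat.div (by norm_num) (mul_ne_zero (by norm_num) hSv.2), padicValRat.mul (by norm_num) hSv.2,
      hv16, hSv.1, show (27 : ℚ) = (3 : ℚ) ^ 3 by norm_num, padicValRat_three_pow]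
    norm_num
  -- assemble
  refine ⟨hϖ, 0, 0, 0, isTameIntegral_zero 3 8, isTameIntegral_zero 3 8, isTameIntegral_zero 3 8, ?_⟩
  show IsTameIntegral 3 8 (C • W.baseChange ℂ).a₁ ∧ IsTameIntegral 3 8 (C • W.baseChange ℂ).a₂ ∧
    IsTameIntegral 3 8 (C • W.baseChange ℂ).a₃ ∧ IsTameIntegral 3 8 (C • W.baseChange ℂ).a₄ ∧
    IsTameIntegral 3 8 (C • W.baseChange ℂ).a₆ ∧
    ∃ y : ℂ, IsTameIntegral 3 8 y ∧ (C • W.baseChange ℂ).Δ * y = 1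
  rw [ha₁, ha₂, ha₃, ha₄, ha₆, hΔ]
  refine ⟨isTameIntegral_zero 3 8, isTameIntegral_zero 3 8, isTameIntegral_zero 3 8, hva₄, hva₆,
    ((27 / (16 * S) : ℚ) : ℂ), hvy, ?_⟩
  have hSC : (S : ℂ) ≠ 0 := by exact_mod_cast hSv.2
  push_cast
  field_simp

end Instance

/-! ### §5 `HasTameGoodModel 3 8 W 2` from the type-III Tate normal form at `3`, and invariance under
`3`-integral changes of variables -/

section TateIII

/-- `v₃(3^k) = k` (private helper). [folklore] -/
private theorem padicValRat_three_pow' (k : ℕ) : padicValRat 3 ((3 : ℚ) ^ k) = k := by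
  haveI : Fact (Nat.Prime 3) := ⟨Nat.prime_three⟩
  rw [padicValRat.pow, show (3 : ℚ) = ((3 : ℕ) : ℚ) by norm_num, padicValRat.self (by norm_num)]
  simp

/-- **`HasTameGoodModel 3 8 W 2` for every rational model in type-III TATE NORMAL FORM at `3`**:
if `3 ∣ a₁, a₂, a₃, a₄` and `9 ∣ a₆` `3`-adically (`v₃(aᵢ/3) ≥ 0`, `v₃(a₆/9) ≥ 0`) and `v₃(Δ) = 3`
(Tate's algorithm, type III: Silverman *ATAEC* IV.9.4 Step 4 — the tree's
`exists_variableChange_tateNormalForm_III` supplies exactly this shape), then over `K = ℚ₃(ϖ)`,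
`ϖ⁸ = −3`, the substitution `(u, r, s, t) = (ϖ², 0, 0, 0)` gives `a₁' = −(a₁/3)ϖ⁶`, `a₂' = −(a₂/3)ϖ⁴`,
`a₃' = −(a₃/3)ϖ²`, `a₄' = −a₄/3`, `a₆' = (a₆/9)ϖ⁴`, `Δ' = −Δ/27 ∈ O_K^×`: good reduction with Néron
exponent `a = 2`. Generalises `hasTameGoodModel_three_eight_two_of_short`.
[cite: SilvermanATAEC1994, IV.9.4 Step 4 and Table 4.1 (type III: v(Δ) = 3)]
[cite: SilvermanAEC2009, VII.1 Prop. 1.3 (d), Remark 1.1] -/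
theorem hasTameGoodModel_three_eight_two_of_tateNormalForm (W : WeierstrassCurve ℚ)
    (h₁ : 0 ≤ padicValRat 3 (W.a₁ / 3)) (h₂ : 0 ≤ padicValRat 3 (W.a₂ / 3))
    (h₃ : 0 ≤ padicValRat 3 (W.a₃ / 3)) (h₄ : 0 ≤ padicValRat 3 (W.a₄ / 3))
    (h₆ : 0 ≤ padicValRat 3 (W.a₆ / 9)) (hΔ : padicValRat 3 W.Δ = 3) :
    HasTameGoodModel 3 8 W 2 := by
  haveI : Fact (Nat.Prime 3) := ⟨Nat.prime_three⟩
  have hϖ : tameUnif 3 8 ≠ 0 := tameUnif_ne_zero 8 (by norm_num)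
  have h8 : tameUnif 3 8 ^ 8 = -3 := by
    have := tameUnif_pow (p := 3) (e := 8) (by norm_num); exact_mod_cast this
  have hΔ0 : W.Δ ≠ 0 := by
    rintro h; rw [h, padicValRat.zero] at hΔ; exact absurd hΔ (by norm_num)
  set ϖ := tameUnif 3 8 with hϖdef
  set C : WeierstrassCurve.VariableChange ℂ := ⟨Units.mk0 (ϖ ^ 2) (pow_ne_zero 2 hϖ), 0, 0, 0⟩ with hC
  have hu : ((C.u⁻¹ : ℂˣ) : ℂ) = (ϖ ^ 2)⁻¹ := by
    rw [Units.val_inv_eq_inv_val, hC, Units.val_mk0]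
  -- negative powers of `ϖ²` in `O_K = ℤ_(3)[ϖ]`
  have hinv2 : (ϖ ^ 2)⁻¹ = -ϖ ^ 6 / 3 :=
    inv_eq_of_mul_eq_one_right (by rw [show ϖ ^ 2 * (-ϖ ^ 6 / 3) = -(ϖ ^ 8) / 3 by ring, h8]; norm_num)
  have hinv4 : (ϖ ^ 2)⁻¹ ^ 2 = -ϖ ^ 4 / 3 := by
    rw [inv_pow, ← pow_mul]
    exact inv_eq_of_mul_eq_one_right (by rw [show ϖ ^ (2 * 2) * (-ϖ ^ 4 / 3) = -(ϖ ^ 8) / 3 by ring, h8]; norm_num)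
  have hinv6 : (ϖ ^ 2)⁻¹ ^ 3 = -ϖ ^ 2 / 3 := by
    rw [inv_pow, ← pow_mul]
    exact inv_eq_of_mul_eq_one_right (by rw [show ϖ ^ (2 * 3) * (-ϖ ^ 2 / 3) = -(ϖ ^ 8) / 3 by ring, h8]; norm_num)
  have hinv8 : (ϖ ^ 2)⁻¹ ^ 4 = -1 / 3 := by
    rw [inv_pow, ← pow_mul]
    exact inv_eq_of_mul_eq_one_right (by rw [show ϖ ^ (2 * 4) * (-1 / 3 : ℂ) = -(ϖ ^ 8) / 3 by ring, h8]; norm_num)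
  have hinv12 : (ϖ ^ 2)⁻¹ ^ 6 = ϖ ^ 4 / 9 := by
    rw [inv_pow, ← pow_mul]
    exact inv_eq_of_mul_eq_one_right (by rw [show ϖ ^ (2 * 6) * (ϖ ^ 4 / 9) = (ϖ ^ 8) ^ 2 / 9 by ring, h8]; norm_num)
  have hinv24 : (ϖ ^ 2)⁻¹ ^ 12 = -1 / 27 := by
    rw [inv_pow, ← pow_mul]
    exact inv_eq_of_mul_eq_one_right (by rw [show ϖ ^ (2 * 12) * (-1 / 27 : ℂ) = -(ϖ ^ 8) ^ 3 / 27 by ring, h8]; norm_num)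
  -- the base-changed coefficients
  have hbc : W.baseChange ℂ = ⟨(W.a₁ : ℂ), (W.a₂ : ℂ), (W.a₃ : ℂ), (W.a₄ : ℂ), (W.a₆ : ℂ)⟩ := by
    ext <;> simp [WeierstrassCurve.baseChange, WeierstrassCurve.map]
  have ha₁ : (C • W.baseChange ℂ).a₁ = (((-(W.a₁ / 3)) : ℚ) : ℂ) * ϖ ^ 6 := by
    rw [WeierstrassCurve.variableChange_a₁, hu, hinv2, hbc, hC]; push_cast; ring
  have ha₂ : (C • W.baseChange ℂ).a₂ = (((-(W.a₂ / 3)) : ℚ) : ℂ) * ϖ ^ 4 := by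
    rw [WeierstrassCurve.variableChange_a₂, hu, hinv4, hbc, hC]; push_cast; simp; ring
  have ha₃ : (C • W.baseChange ℂ).a₃ = (((-(W.a₃ / 3)) : ℚ) : ℂ) * ϖ ^ 2 := by
    rw [WeierstrassCurve.variableChange_a₃, hu, hinv6, hbc, hC]; push_cast; simp; ring
  have ha₄ : (C • W.baseChange ℂ).a₄ = (((-(W.a₄ / 3)) : ℚ) : ℂ) := by
    rw [WeierstrassCurve.variableChange_a₄, hu, hinv8, hbc, hC]; push_cast; simp; ring
  have ha₆ : (C • W.baseChange ℂ).a₆ = (((W.a₆ / 9) : ℚ) : ℂ) * ϖ ^ 4 := by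
    rw [WeierstrassCurve.variableChange_a₆, hu, hinv12, hbc, hC]; push_cast; simp; ring
  have hΔ' : (C • W.baseChange ℂ).Δ = (((-(W.Δ / 27)) : ℚ) : ℂ) := by
    rw [WeierstrassCurve.variableChange_Δ, hu, hinv24, WeierstrassCurve.baseChange, WeierstrassCurve.map_Δ]
    push_cast; simp; ring
  -- integrality of the witnesses
  have hva₁ : IsTameIntegral 3 8 ((((-(W.a₁ / 3)) : ℚ) : ℂ) * ϖ ^ 6) :=
    isTameIntegral_ratCast_mul_tameUnif_pow Nat.prime_three (by norm_num) (by rwa [padicValRat.neg]) 6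
  have hva₂ : IsTameIntegral 3 8 ((((-(W.a₂ / 3)) : ℚ) : ℂ) * ϖ ^ 4) :=
    isTameIntegral_ratCast_mul_tameUnif_pow Nat.prime_three (by norm_num) (by rwa [padicValRat.neg]) 4
  have hva₃ : IsTameIntegral 3 8 ((((-(W.a₃ / 3)) : ℚ) : ℂ) * ϖ ^ 2) :=
    isTameIntegral_ratCast_mul_tameUnif_pow Nat.prime_three (by norm_num) (by rwa [padicValRat.neg]) 2
  have hva₄ : IsTameIntegral 3 8 (((-(W.a₄ / 3)) : ℚ) : ℂ) :=
    IsPIntegral.isTameIntegral (by norm_num) ⟨-(W.a₄ / 3), by rwa [padicValRat.neg], rfl⟩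
  have hva₆ : IsTameIntegral 3 8 ((((W.a₆ / 9) : ℚ) : ℂ) * ϖ ^ 4) :=
    isTameIntegral_ratCast_mul_tameUnif_pow Nat.prime_three (by norm_num) h₆ 4
  have hvy : IsTameIntegral 3 8 (((-(27 / W.Δ)) : ℚ) : ℂ) := by
    refine IsPIntegral.isTameIntegral (by norm_num) ⟨-(27 / W.Δ), ?_, rfl⟩
    rw [padicValRat.neg, padicValRat.div (by norm_num) hΔ0, hΔ, show (27 : ℚ) = (3 : ℚ) ^ 3 by norm_num,
      padicValRat_three_pow']
    norm_num
  -- assemble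
  refine ⟨hϖ, 0, 0, 0, isTameIntegral_zero 3 8, isTameIntegral_zero 3 8, isTameIntegral_zero 3 8, ?_⟩
  show IsTameIntegral 3 8 (C • W.baseChange ℂ).a₁ ∧ IsTameIntegral 3 8 (C • W.baseChange ℂ).a₂ ∧
    IsTameIntegral 3 8 (C • W.baseChange ℂ).a₃ ∧ IsTameIntegral 3 8 (C • W.baseChange ℂ).a₄ ∧
    IsTameIntegral 3 8 (C • W.baseChange ℂ).a₆ ∧
    ∃ y : ℂ, IsTameIntegral 3 8 y ∧ (C • W.baseChange ℂ).Δ * y = 1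
  rw [ha₁, ha₂, ha₃, ha₄, ha₆, hΔ']
  refine ⟨hva₁, hva₂, hva₃, hva₄, hva₆, (((-(27 / W.Δ)) : ℚ) : ℂ), hvy, ?_⟩
  have hΔC : (W.Δ : ℂ) ≠ 0 := by exact_mod_cast hΔ0
  push_cast
  field_simp

/-- **`HasTameGoodModel` is insensitive to `p`-integral changes of variables with unit scaling**
(Silverman *AEC* VII.1.3 (d): two `p`-integral models with the same (minimal) discriminant valuation
differ by `(u, r, s, t)` with `u ∈ ℤ_pˣ`, `r, s, t ∈ ℤ_p`): if `C = (u, r, s, t)` has `v_p(u) = 0` and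
`r, s, t` `p`-integral and `C • W` acquires good reduction over `K` with Néron exponent `a`
(`HasTameGoodModel p e (C • W) a`), then so does `W`, with the SAME exponent `a` — the witness for `W`
is `(ϖ^a, r', s', t')` with `(r', s', t')` read off from `(ϖ^a, r₀, s₀, t₀) ∘ C` and the good model
rescaled by the unit `u⁻¹`. (Used with the tree's `exists_variableChange_tateNormalForm_III` to reach
`hasTameGoodModel_three_eight_two_of_tateNormalForm` from a globally minimal `W` of type III at `3`.)
[cite: SilvermanAEC2009, VII.1 Prop. 1.3 (d)] -/
theorem HasTameGoodModel.of_variableChange {p e : ℕ} (hp : p.Prime) (he : 0 < e)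
    {W : WeierstrassCurve ℚ} (C : WeierstrassCurve.VariableChange ℚ) {a : ℕ}
    (hu : padicValRat p (C.u : ℚ) = 0) (hr : 0 ≤ padicValRat p C.r) (hs : 0 ≤ padicValRat p C.s)
    (ht : 0 ≤ padicValRat p C.t) (h : HasTameGoodModel p e (C • W) a) :
    HasTameGoodModel p e W a := by
  haveI : Fact p.Prime := ⟨hp⟩
  obtain ⟨hϖ, r, s, t, hr', hs', ht', hgood⟩ := h
  set ϖ := tameUnif p e with hϖdef
  -- notation: `uC` the rational unit, `Cc` the complexified change, `V` the given witness for `C • W`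
  set uC : ℚ := (C.u : ℚ) with huC
  have huC0 : uC ≠ 0 := by rw [huC]; exact C.u.ne_zero
  have huCinv : padicValRat p uC⁻¹ = 0 := by rw [padicValRat.inv, hu, neg_zero]
  have hupow : ∀ n : ℕ, 0 ≤ padicValRat p (uC ^ n) := fun n ↦ by rw [padicValRat.pow, hu, mul_zero]
  have hupow' : ∀ n : ℕ, 0 ≤ padicValRat p (uC⁻¹ ^ n) := fun n ↦ by
    rw [padicValRat.pow, huCinv, mul_zero]
  set Cc : WeierstrassCurve.VariableChange ℂ := C.map (algebraMap ℚ ℂ) with hCc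
  have hCcu : ((Cc.u : ℂˣ) : ℂ) = (uC : ℂ) := by rw [hCc]; rfl
  have hCcr : Cc.r = (C.r : ℂ) := rfl
  have hCcs : Cc.s = (C.s : ℂ) := rfl
  have hCct : Cc.t = (C.t : ℂ) := rfl
  have hbase : (C • W).baseChange ℂ = Cc • W.baseChange ℂ := by
    rw [WeierstrassCurve.baseChange, WeierstrassCurve.baseChange, hCc, WeierstrassCurve.map_variableChange]
  set V : WeierstrassCurve.VariableChange ℂ := ⟨Units.mk0 (ϖ ^ a) (pow_ne_zero a hϖ), r, s, t⟩ with hV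
  -- the new witness `(ϖ^a, r', s', t')` and the unit rescaling `U = (uC⁻¹, 0, 0, 0)`
  set r' : ℂ := r * (uC : ℂ) ^ 2 + (C.r : ℂ) with hr'def
  set s' : ℂ := (uC : ℂ) * s + (C.s : ℂ) with hs'def
  set t' : ℂ := t * (uC : ℂ) ^ 3 + r * (C.s : ℂ) * (uC : ℂ) ^ 2 + (C.t : ℂ) with ht'def
  set V' : WeierstrassCurve.VariableChange ℂ := ⟨Units.mk0 (ϖ ^ a) (pow_ne_zero a hϖ), r', s', t'⟩ with hV'
  have huCC : (uC : ℂ) ≠ 0 := by exact_mod_cast huC0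
  set U : WeierstrassCurve.VariableChange ℂ := ⟨Units.mk0 ((uC : ℂ)⁻¹) (inv_ne_zero huCC), 0, 0, 0⟩ with hU
  have hUu : ((U.u⁻¹ : ℂˣ) : ℂ) = (uC : ℂ) := by
    rw [Units.val_inv_eq_inv_val, hU, Units.val_mk0, inv_inv]
  have hVU : V' = U * (V * Cc) := by
    have hunit : Units.mk0 (ϖ ^ a) (pow_ne_zero a hϖ) =
        Units.mk0 ((uC : ℂ)⁻¹) (inv_ne_zero huCC) * (Units.mk0 (ϖ ^ a) (pow_ne_zero a hϖ) * Cc.u) := by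
      ext
      rw [Units.val_mul, Units.val_mul, Units.val_mk0, Units.val_mk0, hCcu]
      field_simp
    rw [hV', hU, hV, WeierstrassCurve.VariableChange.mul_def, WeierstrassCurve.VariableChange.mul_def]
    simp only [hCcr, hCcs, hCct, hCcu, zero_mul, zero_add, mul_zero, add_zero, ← hunit]
    rw [hr'def, hs'def, ht'def]
  have hmodel : V' • W.baseChange ℂ = U • (V • (C • W).baseChange ℂ) := by
    rw [hVU, mul_smul, mul_smul, hbase]
  -- integrality of `r', s', t'`
  have hir' : IsTameIntegral p e r' := by
    have h1 := hr'.ratCast_mul hp (hupow 2)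
    rw [Rat.cast_pow, mul_comm] at h1
    exact h1.add hp (IsPIntegral.isTameIntegral he ⟨C.r, hr, rfl⟩)
  have his' : IsTameIntegral p e s' :=
    (hs'.ratCast_mul hp (le_of_eq hu.symm)).add hp (IsPIntegral.isTameIntegral he ⟨C.s, hs, rfl⟩)
  have hit' : IsTameIntegral p e t' := by
    have h1 := ht'.ratCast_mul hp (hupow 3)
    rw [Rat.cast_pow, mul_comm] at h1
    have hq : 0 ≤ padicValRat p (C.s * uC ^ 2) := by
      rcases eq_or_ne C.s 0 with h0 | h0
      · rw [h0, zero_mul, padicValRat.zero]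
      · rw [padicValRat.mul h0 (pow_ne_zero 2 huC0)]; exact add_nonneg hs (hupow 2)
    have h2 := hr'.ratCast_mul hp hq
    rw [show (((C.s * uC ^ 2 : ℚ)) : ℂ) * r = r * (C.s : ℂ) * (uC : ℂ) ^ 2 by push_cast; ring] at h2
    exact (h1.add hp h2).add hp (IsPIntegral.isTameIntegral he ⟨C.t, ht, rfl⟩)
  -- the good model of `C • W`, rescaled by the unit `uC⁻¹`
  obtain ⟨g₁, g₂, g₃, g₄, g₆, y, hy, hΔy⟩ := hgood
  set W₂ := V • (C • W).baseChange ℂ with hW₂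
  refine ⟨hϖ, r', s', t', hir', his', hit', ?_⟩
  show IsTameIntegral p e (V' • W.baseChange ℂ).a₁ ∧ IsTameIntegral p e (V' • W.baseChange ℂ).a₂ ∧
    IsTameIntegral p e (V' • W.baseChange ℂ).a₃ ∧ IsTameIntegral p e (V' • W.baseChange ℂ).a₄ ∧
    IsTameIntegral p e (V' • W.baseChange ℂ).a₆ ∧
    ∃ y : ℂ, IsTameIntegral p e y ∧ (V' • W.baseChange ℂ).Δ * y = 1
  rw [hmodel, WeierstrassCurve.variableChange_a₁, WeierstrassCurve.variableChange_a₂,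
    WeierstrassCurve.variableChange_a₃, WeierstrassCurve.variableChange_a₄,
    WeierstrassCurve.variableChange_a₆, WeierstrassCurve.variableChange_Δ, hUu, hU]
  simp only [mul_zero, add_zero, zero_mul, sub_zero, zero_pow two_ne_zero, zero_pow three_ne_zero]
  have hp2 := g₂.ratCast_mul hp (hupow 2)
  have hp3 := g₃.ratCast_mul hp (hupow 3)
  have hp4 := g₄.ratCast_mul hp (hupow 4)
  have hp6 := g₆.ratCast_mul hp (hupow 6)
  rw [Rat.cast_pow] at hp2 hp3 hp4 hp6
  refine ⟨g₁.ratCast_mul hp (le_of_eq hu.symm), hp2, hp3, hp4, hp6,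
    (((uC⁻¹ ^ 12 : ℚ)) : ℂ) * y, hy.ratCast_mul hp (hupow' 12), ?_⟩
  calc (uC : ℂ) ^ 12 * W₂.Δ * ((((uC⁻¹ ^ 12 : ℚ)) : ℂ) * y)
      = ((uC : ℂ) * (uC : ℂ)⁻¹) ^ 12 * (W₂.Δ * y) := by push_cast; ring
    _ = 1 := by rw [hΔy, mul_inv_cancel₀ huCC, one_pow, one_mul]

end TateIII

/-! ### §6 The Abbes–Ullmo road at a general prime `p`: the valuation law of the dual pullback on `L`
(appended 2026-08-29, typer g35 — the mechanism behind pen bsd-idea-3 LINE 42 «Néron congruence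
saturation», stated once over the carrier for every `(N, p, e)`; theorems only)

For a lattice-optimal datum `D` (Manin constant `c`, modular degree `deg φ`, newform `f`) and
`g ∈ L = Λ.lattice` write `⟨f, g⟩ = t·⟨f, f⟩` (`t = λ_f(g) ∈ ℚ`, Abbes–Ullmo's `λ_f`). The carrier's
`pullback_integral` (Néron functoriality of `π^∨`, ČNS Lemma 7.1 / proof of Thm. 7.2; Abbes–Ullmo
Lemme 3.1: `(π^∨)^* g = λ_f(g)·(deg φ/c)·ω_W`) says `deg φ · t = t'·c` with `v_p(t') ≥ 0`, whence the
VALUATION LAW `v_p(deg φ) + v_p(t) = v_p(t') + v_p(c) ≥ v_p(c)`: (i) `v_p(c) − v_p(deg φ) ≤ v_p(λ_f(g))`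
for every `g ∈ L` (so a congruence of depth `> v_p(deg φ) − v_p(c)` with a Néron differential is
impossible — at `p ∤ N`, where `L = S₂(ℤ_(p))`, this is Abbes–Ullmo's `v_p(r) + v_p(c) ≤ v_p(deg φ)`),
and (ii) a witness `g ∈ L` with `v_p(λ_f(g)) ≤ −v_p(deg φ)` forces `p ∤ c` (the road of Abbes–Ullmo's
Thm. A, `deg φ ∣ r ⇒ p ∤ c`, transported to any `p` at which `L` is available). The case `g = f`,
`t = 1` of (i) is §3's `padicValInt_maninConstant_le_padicValNat_modularDegree` (ČNS Thm. 1.2 at `p`). -/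

section AbbesUllmoRoad

namespace TameNeronFormsAt

variable {N : ℕ} [NeZero N] {p e : ℕ} (Λ : TameNeronFormsAt N p e)

include Λ in
/-- **Valuation law of the dual pullback, (i)**: for a lattice-optimal datum `D` and `g ∈ L` with
`⟨f, g⟩ = t·⟨f, f⟩`, `t ≠ 0`: `v_p(c) − v_p(deg φ) ≤ v_p(t)` (from `pullback_integral`:
`deg φ·t = t'·c`, `v_p(t') ≥ 0`, and `⟨f, f⟩ ≠ 0`).
[cite: AbbesUllmo1996, Lemme 3.1 (p. 275) and proof of Thm. A (p. 279)]
[cite: CesnaviciusNeururerSaha2023, Lemma 7.1, Thm. 7.2 and proof (pp. 46–47)] -/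
theorem padicValInt_maninConstant_sub_le_padicValRat (hp : p.Prime)
    {W : WeierstrassCurve ℚ} [W.IsElliptic] [W.IsGloballyMinimal] (D : ModularParametrizationData W N)
    (hopt : ∀ z ∈ D.L.lattice, ∃ w ∈ periodLattice D.f, z = D.c * w)
    {g : CuspForm (Gamma0 N) 2} (hg : g ∈ Λ.lattice) {t : ℚ} (ht0 : t ≠ 0)
    (hfg : peterssonProduct (Gamma0 N) 2 D.f g = (t : ℂ) * peterssonProduct (Gamma0 N) 2 D.f D.f) :
    (padicValInt p D.maninConstant : ℤ) - padicValNat p D.modularDegree ≤ padicValRat p t := by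
  haveI : Fact p.Prime := ⟨hp⟩
  obtain ⟨t', ht', hpull⟩ := Λ.pullback_integral W D hopt g hg
  have hff : peterssonProduct (Gamma0 N) 2 D.f D.f ≠ 0 := by
    intro h
    have hpos := peterssonProduct_self_pos_holds (Gamma0 N) 2
      (IsNormalized.ne_zero D.isNewformOf.1.2.2)
    rw [h, Complex.zero_re] at hpos
    exact lt_irrefl _ hpos
  rw [hfg, ← mul_assoc] at hpull
  have hdeg : (D.modularDegree : ℂ) * (t : ℂ) = (t' : ℂ) * (D.maninConstant : ℂ) :=
    mul_right_cancel₀ hff hpull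
  have hdegQ : (D.modularDegree : ℚ) * t = t' * D.maninConstant := by exact_mod_cast hdeg
  have hd0 : (D.modularDegree : ℚ) ≠ 0 := by exact_mod_cast D.deg_pos.ne'
  have hc0 : (D.maninConstant : ℚ) ≠ 0 := by
    exact_mod_cast ModularParametrizationData.maninConstant_ne_zero_holds D
  have ht'0 : t' ≠ 0 := by
    intro h; rw [h, zero_mul] at hdegQ; exact (mul_ne_zero hd0 ht0) hdegQ
  have hval : padicValRat p (D.modularDegree : ℚ) + padicValRat p t =
      padicValRat p t' + padicValRat p (D.maninConstant : ℚ) := by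
    rw [← padicValRat.mul hd0 ht0, hdegQ, padicValRat.mul ht'0 hc0]
  rw [← padicValRat_of_nat, padicValRat.of_int] at hval
  linarith

include Λ in
/-- **Valuation law of the dual pullback, (ii) — the Abbes–Ullmo road to `p ∤ c`**: a lattice witness
`g ∈ L` with `⟨f, g⟩ = t·⟨f, f⟩`, `t ≠ 0` and `v_p(t) ≤ −v_p(deg φ)` (a congruence of `f` with a Néron
differential of depth `≥ v_p(deg φ)`) forces `p ∤ c` (by (i): `v_p(c) ≤ v_p(deg φ) + v_p(t) ≤ 0`).
At `p ∤ N` (`L = S₂(ℤ_(p))`, depth `= v_p(r_f) ≥ v_p(deg φ)` by Ribet's `deg φ ∣ r`) this is the proof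
of Abbes–Ullmo's Thm. A; the pen's cruxes N42 / N42*′ assert such witnesses at `p = 3`, `9 ∥ N`.
[cite: AbbesUllmo1996, Thm. A (p. 269) and its proof (p. 279); Lemme 3.1 (p. 275)]
[cite: CesnaviciusNeururerSaha2023, Lemma 7.1, Thm. 7.2 and proof (pp. 46–47)] -/
theorem not_dvd_maninConstant_of_latticeWitness (hp : p.Prime)
    {W : WeierstrassCurve ℚ} [W.IsElliptic] [W.IsGloballyMinimal] (D : ModularParametrizationData W N)
    (hopt : ∀ z ∈ D.L.lattice, ∃ w ∈ periodLattice D.f, z = D.c * w)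
    {g : CuspForm (Gamma0 N) 2} (hg : g ∈ Λ.lattice) {t : ℚ} (ht0 : t ≠ 0)
    (hv : padicValRat p t + padicValNat p D.modularDegree ≤ 0)
    (hfg : peterssonProduct (Gamma0 N) 2 D.f g = (t : ℂ) * peterssonProduct (Gamma0 N) 2 D.f D.f) :
    ¬ (p : ℤ) ∣ D.maninConstant := by
  haveI : Fact p.Prime := ⟨hp⟩
  have hle := Λ.padicValInt_maninConstant_sub_le_padicValRat hp D hopt hg ht0 hfg
  intro hdvd
  have hc1 : 1 ≤ padicValInt p D.maninConstant := by
    rcases (padicValInt_dvd_iff (p := p) 1 D.maninConstant).1 (by simpa using hdvd) with h0 | h1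
    · exact absurd h0 (ModularParametrizationData.maninConstant_ne_zero_holds D)
    · exact h1
  have hc1' : (1 : ℤ) ≤ padicValInt p D.maninConstant := by exact_mod_cast hc1
  have hcast : ((padicValNat p D.modularDegree : ℤ) : ℚ) = (padicValNat p D.modularDegree : ℚ) := by
    norm_cast
  have hleQ : ((padicValInt p D.maninConstant : ℤ) : ℚ) - (padicValNat p D.modularDegree : ℚ) ≤
      padicValRat p t := by
    have := hle
    push_cast at this ⊢
    linarith
  have h1Q : (1 : ℚ) ≤ ((padicValInt p D.maninConstant : ℤ) : ℚ) := by exact_mod_cast hc1'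
  linarith

end TameNeronFormsAt

end AbbesUllmoRoad

end Literature.NumberTheory.EllipticCurves.ModularForms

end
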